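import Summits.NavierStokesRegularity.NavierStokesRegularity.Theorems.UnthreadedDoorIndicatrixTypeIHessianBound
import Literature.Analysis.FluidPDE.TaoEnstrophyLocalisation
import HarnessLib

/-!
# Type-I velocity ⇒ Type-I vorticity gradient for bounded ancient mild solutions
# (`TypeIVorticityGradientBound`, Λ-T of the crux idea «indicatrix-bound» on crux `PoloidalLiouville`, stmt-NavierStokesRegularity-1222)

Support file for crux `PoloidalLiouville` (wall W1; crux idea «indicatrix-bound» of planner ns-idea-14,
`Cruxes/PoloidalLiouville/IndicatrixSketch.lean`, support Prop Λ-T `TypeIVorticityGradientBound` — documentary on the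
provers' path since v1.2, still typed).  Experiment cell `pub/ns-wall-extremal` (req171), seat ns-wall-eng-4 g7.
Theorems only; no definitions, no named facts; nothing here proves `PoloidalLiouville`, `stub_scalarLiouville` or
Navier–Stokes regularity.

THE STATEMENT (body of the sketch's `TypeIVorticityGradientBound` VERBATIM, here
`PoloidalLiouville.Indicatrix.typeIVorticityGradientBound`): a bounded ancient mild solution (`ν = 1`, duality
class) smooth on `(−∞,0) × ℝ³` with `‖v(t,x)‖ ≤ C/√(−t)` has `‖∇(curl v(t))(x)‖ ≤ C₂/√(−t)³`.

THE PROOF: the Hessian bound Λ-T′ (`typeIHessianBound`, KNSS 2009 (4.10) with `k = 2`) and the pointwise chain rule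
`‖D(curl w)(x)‖ ≤ ‖curlCLM‖·‖D²w(x)‖` (`Literature.Analysis.FluidPDE.norm_fderiv_curl_le`) for the `C²` slice `v(t)`;
`C₂ := ‖curlCLM‖ · C₂(Λ-T′)`.

## References
* G. Koch, N. Nadirashvili, G. Seregin, V. Šverák, Acta Math. 203 (2009) 83–105 = arXiv:0709.3599, (1.4), §4 Prop. 4.1
  with (4.10). [KochNadirashviliSereginSverak2009]
* planner ns-idea-14, `Cruxes/PoloidalLiouville/IndicatrixSketch.lean` (Λ-T).
-/

-- the summit and its single problem share the name (D-0017 nested layout)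
set_option linter.dupNamespace false

noncomputable section

namespace Summit.NavierStokesRegularity.NavierStokesRegularity.Theorems

open MeasureTheory Filter Set Function Metric
open scoped Topology
open Literature.Analysis Literature.Analysis.FluidPDE

namespace PoloidalLiouville.Indicatrix

/-- **Type-I velocity ⇒ Type-I vorticity gradient** (the body of the indicatrix card's
`TypeIVorticityGradientBound`, Λ-T, VERBATIM): a bounded ancient mild solution of Navier–Stokes (`ν = 1`,
duality class), smooth on `(−∞,0) × ℝ³`, with `‖v(t,x)‖ ≤ C/√(−t)`, has `‖∇(curl v(t))(x)‖ ≤ C₂/√(−t)³` for one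
constant `C₂` and all `t < 0`, `x` — the Hessian bound `typeIHessianBound` composed with
`‖D(curl w)(x)‖ ≤ ‖curlCLM‖‖D²w(x)‖`.
[cite: KochNadirashviliSereginSverak2009, (1.4), Prop. 4.1 with (4.10) (arXiv:0709.3599v1 pp. 2, 8)] -/
theorem typeIVorticityGradientBound :
    ∀ (v : ℝ → EuclideanSpace ℝ (Fin 3) → EuclideanSpace ℝ (Fin 3)) (C : ℝ),
      IsBoundedAncientMildSolution 1 v → HasTypeITimeDecay C v →
      ContDiffOn ℝ (⊤ : ℕ∞) (uncurry v) (Iio 0 ×ˢ univ) →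
      ∃ C₂ : ℝ, ∀ t < 0, ∀ x, ‖fderiv ℝ (curl (v t)) x‖ ≤ C₂ / Real.sqrt (-t) ^ 3 := by
  intro u C hB hT hsm
  obtain ⟨C₂, hC₂⟩ := typeIHessianBound u C hB hT hsm
  refine ⟨‖curlCLM‖ * C₂, fun t ht x => ?_⟩
  -- the slice `u t` is `C^∞`, in particular `C²`
  have hsl : ContDiff ℝ (⊤ : ℕ∞) (u t) :=
    hsm.comp_contDiff (contDiff_prodMk_right t) fun y => mk_mem_prod (mem_Iio.2 ht) (mem_univ y)
  have h2 : ContDiff ℝ 2 (u t) := contDiff_infty.1 hsl 2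
  have hst : 0 < Real.sqrt (-t) ^ 3 := pow_pos (Real.sqrt_pos.2 (by linarith)) 3
  calc ‖fderiv ℝ (curl (u t)) x‖ ≤ ‖curlCLM‖ * ‖iteratedFDeriv ℝ 2 (u t) x‖ := norm_fderiv_curl_le h2 x
    _ ≤ ‖curlCLM‖ * (C₂ / Real.sqrt (-t) ^ 3) := by gcongr; exact hC₂ t ht x
    _ = ‖curlCLM‖ * C₂ / Real.sqrt (-t) ^ 3 := by ring

end PoloidalLiouville.Indicatrix

end Summit.NavierStokesRegularity.NavierStokesRegularity.Theorems

end
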